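import Summits.AtomisticToContinuum.HydrodynamicLimit.Theorems.MourreKoopmanChargesLinearToEntropyInBandDefs
import Literature.Analysis.FluidPDE.HardSphereCollisionRecord
import Literature.MathematicalPhysics.KineticTheory.HardSphereEulerProofs
import HarnessLib

/-!
# Route `MourreKoopmanCharges` — posited objects of the crux line for `LinearToEntropyInBand`, part B

§ 3 of the objects module of the crux `MourreKoopmanCharges.LinearToEntropyInBand`
(stmt-AtomisticToContinuum-17740, line `registered`): the typed objects of the BALL-WISE ONE-BLOCK
DECOMPOSITION of the v6 stub 4a `stub_windowClauseVisibleInBand` (skeleton v7), following the wave-3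
architecture audit `work/stubs/w3/AUDIT-4a.md` (lead prover-line-…-17740-c4-0).  Part A
(`…LinearToEntropyInBandDefs`, p146669) holds § 1 (packing-guarded truncation inputs) and § 2 (visible local
flux-Gibbsianity); it is imported, never modified.  New here:

* (a) `InvisibleCollisionThroughputW η` / `…InBand` — PER-WINDOW throughput of collisions with an INVISIBLE
  endpoint (fast OR mesoscopically dense), replacing the integrated `FastCollisionThroughputBelow η` in 4a
  (AUDIT-4a § 2 (e1)); verbatim from the audit's kernel-checked scratch;
* (b) `FastCollisionThroughputW η` — the FAST half of (a) (same integrand, no density test, no `R`), the shape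
  the Lanford envelope delivers first (p155741 per window); `fastCollisionThroughputW_of_invisible` is (a) ⇒ (b);
* (c) `MeanWindowTransferActivityBelow η` — the per-window MEAN transfer activity `E[(N+1)⁻¹ Σᵢ actᵢ] ≤ C`
  (AUDIT-4a § 2 (e2)), `act` byte-for-byte that of `TwoClocks.TransferActivityTails` / CAT / CEAT, docking with
  `glue_activityTailZero_of_pairEnvelope` (p158163);
* (d) `MesoscopicBlockLD` — the STATIC input of the quadratic one-block remainder (AUDIT-4a § 3 item 5):
  Gaussian-scale exponential moments of the cone-smoothed VISIBLE empirical density and momentum around the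
  profile, and exponential smallness of the quadratic content of the mesoscopically DENSE particles, under the
  explicit canonical local Gibbs reference family of the window clause, in the dilute band (TRUE-grade statics);
* (e) `VisibleN`, `visDensityN`, `visMomentumN`, `visEnergyN`, `visCoreN` — the `N`-system transcription of
  `Visible` / `visCore` (reference parameters = the Euler fields frozen at the window start, visibility threshold
  `(3/2) ρ_s(xᵢ)`, EOS argument `min(ρ̄, 2ρ_s(x)) σ³`, window `(s, s + τ(N+1)^{-1/3}]` along `Φ.flow`), and
  `VisibleOneBlockEstimateInBand` — the conclusion of v7's stub 4a-i (AUDIT-4a § 3, last paragraph), with the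
  `(r, Rf)` prefix of `HydroLimitInBandHeart.WindowClauseInBand` verbatim so that 4a-ii docks;
* (f) the registered bookkeeping stub `stub_objectsV7` (antitonicity of (a)–(c), and (a) ⇒ (b)), sorry-free.

Lean conventions (documented junk): `x / 0 = 0`, `0⁻¹ = 0` in the block fields, `Real.log` / `deriv` junk
inside `hsCompressibility`, `Function.leftLim` / `finsum` junk off the Liouville-conull good set of the flow (an
infinite collision-time set in a window makes the `finsum` vanish; invisible under `localGibbsLaw`, which is
carried by the good set), Bochner junk `0` for a non-integrable integrand (so `VisibleOneBlockEstimateInBand`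
asserts integrability), `klDiv = ⊤ ↦ toReal = 0` (excluded along the line by
`JaynesSqueezeClosure.klDiv_lawAt_localGibbsLaw_ne_top`), empty windows `t < w` make window clauses vacuous.
Nothing here restates the crux, the route's items or the Statement; (a)–(e) are posited OPEN inputs /
conclusions of v7's stubs 4a-i/ii/iii, never asserted.  References: Yau1991 §2, OllaVaradhanYau1993 §3–4,
Spohn1991 Part I §3.3, CercignaniIllnerPulvirenti1994 App. 4.A, KipnisLandim1999 Ch. 6 and App. 2.
-/

noncomputable section

open MeasureTheory Filter Set
open scoped ENNReal Topology InnerProductSpace BigOperators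

namespace Summit.AtomisticToContinuum.HydrodynamicLimit.Theorems.LTEInBand

open Literature.MathematicalPhysics.KineticTheory Literature.Analysis.FluidPDE Literature.Analysis.FunctionSpaces

/-! ## § 3 Objects of the ball-wise one-block decomposition (skeleton v7; AUDIT-4a) -/

/-! ### (a) Per-window throughput of invisible collisions -/

/-- **Per-window throughput of INVISIBLE collisions below packing level `η`** (AUDIT-4a § 2 (e1), § 3 item 6;
the antecedent of v7's stub 4a-ii replacing v5's integrated `FastCollisionThroughputBelow η`, and the first
conjunct of the conclusion of stub 4a-iii).  Along every guarded classical solution and flow family with local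
Gibbs data converging at `t = 0`: `∀ t < T ∀ η' > 0 ∃ K₀ ∀ K ≥ K₀ ∀ R ≥ K₀ ∃ τ₀ ∀ τ ≥ τ₀ ∃ N₀ ∀ N ≥ N₀ ∀ s ∈ [0,t]`,
`(τ(N+1))⁻¹ E[Σᵢ Σ_(collisions s' ∈ (s, s+w]) 𝟙(particle i is FAST (max(|vᵢ(s'⁻)|,|vᵢ(s')|) > K) OR DENSE
((N+1)⁻¹ Σⱼ cone R N xᵢ xⱼ > (5/4) ρ_{s'}(xᵢ)) at s') (1 + |vᵢ(s')+vᵢ(s'⁻)|/2)|vᵢ(s') − vᵢ(s'⁻)|] ≤ η'`,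
`w = τ(N+1)^{-1/3}` (one micro window holds `≍ τ(N+1)` collisions, hence the normalisation).  Differences with
`FastCollisionThroughputBelow` (stmt-13022 in band): PER WINDOW (`∀ s` innermost) instead of integrated over
`(0,t]` with `(N+1)^{-4/3}`; and the indicator also fires on MESOSCOPICALLY DENSE particles (cone density at
radius `R(N+1)^{-1/3}` above `5/4 ×` the local Euler density — any constant in `(1, 3/2)` works), exactly the
collisions the visible functional `visCoreN` drops and whose pair-kernel `≤ C ε_N (1 + |v⁺+v⁻|/2)|Δv|` no
time-marginal input sees.  Junk: off the good set of `Φ N` the collision-time set of a window may be infinite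
and the `finsum` is `0`; `Function.leftLim` is junk there too — invisible, `localGibbsLaw` is carried by the
good set.  Verbatim from `work/stubs/w3/audit4a_scratch.lean` (rc 0). -/
def InvisibleCollisionThroughputW (η : ℝ) : Prop :=
  ∀ (a₀ θ₀ : T3 → ℝ) (u₀ : T3 → V3), Continuous a₀ → Continuous θ₀ → Continuous u₀ → (∀ x, 0 < a₀ x) →
    (∀ x, 0 < θ₀ x) → ∃ σ₀ : ℝ, 0 < σ₀ ∧ ∀ σ : ℝ, 0 < σ → σ < σ₀ →
    ∀ (T : ℝ) (ρ θ : ℝ → T3 → ℝ) (u : ℝ → T3 → V3), IsHardSphereEulerSolution σ T ρ u θ →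
    (∀ t ∈ Set.Ico 0 T, ∀ x, ρ t x * σ ^ 3 < η) →
    ∀ Φ : (N : ℕ) → HardSphereFlow (Torus.geometry (Fin 3)) (hsDiameter σ N) (N + 1),
    TendstoHydroFieldsAt (fun N => localGibbsLaw σ a₀ u₀ θ₀ N (Φ N)) Φ ρ u θ 0 →
    ∀ t ∈ Set.Ico 0 T, ∀ η' : ℝ, 0 < η' → ∃ K₀ : ℝ, ∀ K : ℝ, K₀ ≤ K → ∀ R : ℝ, K₀ ≤ R →
    ∃ τ₀ : ℝ, 0 < τ₀ ∧ ∀ τ : ℝ, τ₀ ≤ τ → ∃ N₀ : ℕ, ∀ N : ℕ, N₀ ≤ N → ∀ s ∈ Set.Icc 0 t,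
      ∫⁻ z, ENNReal.ofReal ((τ * ((N : ℝ) + 1))⁻¹ * ∑ i : Fin (N + 1),
        ∑ᶠ s' ∈ collisionTimes (Torus.geometry (Fin 3)) (hsDiameter σ N) (fun r => (Φ N).flow r z) ∩
            Set.Ioc s (s + τ * ((N : ℝ) + 1) ^ (-(1 / 3 : ℝ))),
          (if K < max ‖(Function.leftLim (fun r => (Φ N).flow r z) s' i).2‖ ‖((Φ N).flow s' z i).2‖ ∨
                5 / 4 * ρ s' ((Φ N).flow s' z i).1 <
                  ((N : ℝ) + 1)⁻¹ * ∑ j : Fin (N + 1), cone R N ((Φ N).flow s' z i).1 ((Φ N).flow s' z j).1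
            then (1 + ‖((Φ N).flow s' z i).2 + (Function.leftLim (fun r => (Φ N).flow r z) s' i).2‖ / 2) *
              ‖((Φ N).flow s' z i).2 - (Function.leftLim (fun r => (Φ N).flow r z) s' i).2‖
            else 0)) ∂(localGibbsLaw σ a₀ u₀ θ₀ N (Φ N)) ≤ ENNReal.ofReal η'

/-- `InvisibleCollisionThroughputW η` for SOME packing level `η > 0`. -/
def InvisibleCollisionThroughputInBand : Prop :=
  ∃ η : ℝ, 0 < η ∧ InvisibleCollisionThroughputW η

/-- The guard is monotone in the packing level, so the per-window invisible throughput is ANTITONE in `η`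
(same two-line proof as `fastCollisionThroughputBelow_antitone`). -/
theorem invisibleCollisionThroughputW_antitone {η η' : ℝ} (hle : η' ≤ η) :
    InvisibleCollisionThroughputW η → InvisibleCollisionThroughputW η' := by
  intro H a₀ θ₀ u₀ ha hθ hu hap hθp
  obtain ⟨σ₀, hσ₀, G⟩ := H a₀ θ₀ u₀ ha hθ hu hap hθp
  exact ⟨σ₀, hσ₀, fun σ hσ hσ' T ρ θ u hE hguard =>
    G σ hσ hσ' T ρ θ u hE fun t ht x => (hguard t ht x).trans_le hle⟩

/-! ### (b) Per-window throughput of fast collisions -/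

/-- **Per-window throughput of FAST collisions below packing level `η`** — (a) with the indicator restricted
to its FAST disjunct `K < max(|vᵢ(s'⁻)|, |vᵢ(s')|)` (no density test, hence no radius `R`), every other
quantifier identical (`∃ K₀ ∀ K ≥ K₀ ∃ τ₀ > 0 ∀ τ ≥ τ₀ ∃ N₀ ∀ N ≥ N₀ ∀ s ∈ [0,t]`, `s` innermost), and the same
integrand as the landed INTEGRATED `FastCollisionThroughputBelow η` (part A § 1) but PER WINDOW
`(s, s + τ(N+1)^{-1/3}]` with the window normalisation `(τ(N+1))⁻¹`.  It is the half of (a) that the Lanford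
pair envelope `BGEndpointRigidity.LanfordEnvelopeR` (stmt-13677) delivers by the argument of p155741 run on one
window (Gaussian factor of the envelope; the envelope constant is taken on the horizon `[0, t+1]`, `N₀(τ)` making
`w ≤ 1`, so `K₀` may precede `τ`); (a) splits as fast ∨ dense and `fastCollisionThroughputW_of_invisible`
records (a) ⇒ (b).  Same junk conventions as (a). -/
def FastCollisionThroughputW (η : ℝ) : Prop :=
  ∀ (a₀ θ₀ : T3 → ℝ) (u₀ : T3 → V3), Continuous a₀ → Continuous θ₀ → Continuous u₀ → (∀ x, 0 < a₀ x) →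
    (∀ x, 0 < θ₀ x) → ∃ σ₀ : ℝ, 0 < σ₀ ∧ ∀ σ : ℝ, 0 < σ → σ < σ₀ →
    ∀ (T : ℝ) (ρ θ : ℝ → T3 → ℝ) (u : ℝ → T3 → V3), IsHardSphereEulerSolution σ T ρ u θ →
    (∀ t ∈ Set.Ico 0 T, ∀ x, ρ t x * σ ^ 3 < η) →
    ∀ Φ : (N : ℕ) → HardSphereFlow (Torus.geometry (Fin 3)) (hsDiameter σ N) (N + 1),
    TendstoHydroFieldsAt (fun N => localGibbsLaw σ a₀ u₀ θ₀ N (Φ N)) Φ ρ u θ 0 →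
    ∀ t ∈ Set.Ico 0 T, ∀ η' : ℝ, 0 < η' → ∃ K₀ : ℝ, ∀ K : ℝ, K₀ ≤ K →
    ∃ τ₀ : ℝ, 0 < τ₀ ∧ ∀ τ : ℝ, τ₀ ≤ τ → ∃ N₀ : ℕ, ∀ N : ℕ, N₀ ≤ N → ∀ s ∈ Set.Icc 0 t,
      ∫⁻ z, ENNReal.ofReal ((τ * ((N : ℝ) + 1))⁻¹ * ∑ i : Fin (N + 1),
        ∑ᶠ s' ∈ collisionTimes (Torus.geometry (Fin 3)) (hsDiameter σ N) (fun r => (Φ N).flow r z) ∩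
            Set.Ioc s (s + τ * ((N : ℝ) + 1) ^ (-(1 / 3 : ℝ))),
          (if K < max ‖(Function.leftLim (fun r => (Φ N).flow r z) s' i).2‖ ‖((Φ N).flow s' z i).2‖
            then (1 + ‖((Φ N).flow s' z i).2 + (Function.leftLim (fun r => (Φ N).flow r z) s' i).2‖ / 2) *
              ‖((Φ N).flow s' z i).2 - (Function.leftLim (fun r => (Φ N).flow r z) s' i).2‖
            else 0)) ∂(localGibbsLaw σ a₀ u₀ θ₀ N (Φ N)) ≤ ENNReal.ofReal η'

/-- `FastCollisionThroughputW η` for SOME packing level `η > 0`. -/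
def FastCollisionThroughputWInBand : Prop :=
  ∃ η : ℝ, 0 < η ∧ FastCollisionThroughputW η

/-- Antitonicity of the per-window fast-collision throughput in the packing level. -/
theorem fastCollisionThroughputW_antitone {η η' : ℝ} (hle : η' ≤ η) :
    FastCollisionThroughputW η → FastCollisionThroughputW η' := by
  intro H a₀ θ₀ u₀ ha hθ hu hap hθp
  obtain ⟨σ₀, hσ₀, G⟩ := H a₀ θ₀ u₀ ha hθ hu hap hθp
  exact ⟨σ₀, hσ₀, fun σ hσ hσ' T ρ θ u hE hguard =>
    G σ hσ hσ' T ρ θ u hE fun t ht x => (hguard t ht x).trans_le hle⟩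

/-- **(a) ⇒ (b).**  Take `R := K`; almost surely under the local Gibbs law the datum is good, the collision
times of a window are then finitely many (`IsHardSphereTrajectory.locFinite`), both `finsum`s are honest finite
sums, and the fast indicator is dominated by the fast-or-dense one termwise (the weight is nonnegative). -/
theorem fastCollisionThroughputW_of_invisible {η : ℝ} :
    InvisibleCollisionThroughputW η → FastCollisionThroughputW η := by
  intro H a₀ θ₀ u₀ ha hθ hu hap hθp
  obtain ⟨σ₀, hσ₀, G⟩ := H a₀ θ₀ u₀ ha hθ hu hap hθp
  refine ⟨σ₀, hσ₀, fun σ hσ hσ' T ρ θ u hE hguard Φ hlim t ht η' hη' => ?_⟩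
  obtain ⟨K₀, hK⟩ := G σ hσ hσ' T ρ θ u hE hguard Φ hlim t ht η' hη'
  refine ⟨K₀, fun K hKK => ?_⟩
  obtain ⟨τ₀, hτ₀, hτ⟩ := hK K hKK K hKK
  refine ⟨τ₀, hτ₀, fun τ hττ => ?_⟩
  obtain ⟨N₀, hN⟩ := hτ τ hττ
  refine ⟨N₀, fun N hNN s hs => (lintegral_mono_ae ?_).trans (hN N hNN s hs)⟩
  have hτpos : 0 < τ := hτ₀.trans_le hττ
  have hgood : ∀ᵐ z ∂(localGibbsLaw σ a₀ u₀ θ₀ N (Φ N)), z ∈ (Φ N).good := by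
    rw [localGibbsLaw_eq]
    exact mem_ae_iff.2 (localGibbsMeasure_absolutelyContinuous σ a₀ u₀ θ₀ N (Φ N) (Φ N).measure_compl_good)
  filter_upwards [hgood] with z hz
  have hfin : (collisionTimes (Torus.geometry (Fin 3)) (hsDiameter σ N) (fun r => (Φ N).flow r z) ∩
      Set.Ioc s (s + τ * ((N : ℝ) + 1) ^ (-(1 / 3 : ℝ)))).Finite :=
    (((Φ N).isTrajectory z hz).locFinite s _).subset (Set.inter_subset_inter_right _ Set.Ioc_subset_Icc_self)
  refine ENNReal.ofReal_le_ofReal (mul_le_mul_of_nonneg_left (Finset.sum_le_sum fun i _ => ?_) (by positivity))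
  rw [finsum_mem_eq_finite_toFinset_sum _ hfin, finsum_mem_eq_finite_toFinset_sum _ hfin]
  refine Finset.sum_le_sum fun s' _ => ?_
  split_ifs with h1 h2 <;> first | exact le_rfl | exact absurd (Or.inl h1) h2 | positivity

/-! ### (c) Per-window mean transfer activity -/

/-- **Per-window MEAN transfer activity below packing level `η`** (AUDIT-4a § 2 (e2)–(e3); antecedent of v7's
stub 4a-ii, second conjunct of the conclusion of stub 4a-iii).  Along every guarded classical solution and flow
family with local Gibbs data converging at `t = 0`: `∀ t < T ∃ C ≥ 0 ∀ τ > 0 ∃ N₀ ∀ N ≥ N₀ ∀ s ∈ [0,t]`,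
`E_P[(N+1)⁻¹ Σᵢ actᵢ] ≤ C`, where `actᵢ := (σ/τ) Σ_(collisions c of i, c.time ∈ (s, s + w]) (‖Δvᵢ‖ + |Δ‖vᵢ‖²|/2)`,
`w = τ(N+1)^{-1/3}` — the `act` functional of `TwoClocks.TransferActivityTails` (stmt-16624) / CAT / CEAT BYTE FOR
BYTE (`HardSphereFlow.collisionSum` over `Set.Ioc s (s + w)` of the record functional `c ↦ if c.fst = i then
‖c.postVel.1 − c.preVel.1‖ + |‖c.postVel.1‖² − ‖c.preVel.1‖²|/2 else 0`), at level `V = 0` and in MEAN instead of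
in tail.  It prices the collision-kernel time-freeze over a window (`≤ C_f w ε_N (|Δv| + |Δe|)` per collision, ALL
collisions) and the test-field time grid of 4a-ii.
WHY `C` BEFORE `τ`: `act` carries the factor `σ/τ` and a window of length `∝ τ`, so its mean is
window-length-free; from a pair envelope with constant `Cₑ` on the horizon `[0, t + 1]` and `N ≥ N₀(τ)` making
`w ≤ 1`, `glue_activityTailZero_of_pairEnvelope` (p158163) with the summed mark `‖v − w‖ (1 + ‖v‖ + ‖w‖)`, flux
bound `J`, and rate `κ = (4 (Cₑ+1) τ σ² (J+1))⁻¹` (normalisation `(N+1)² ε_N² w = σ² τ (N+1)`) gives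
`C = 4 (Cₑ+1) σ³ (J+1)`; the consumers fix `τ` after `C` anyway.  Junk: `collisionSum` is a `finsum`, `0` off
the good set (invisible under `P`). -/
def MeanWindowTransferActivityBelow (η : ℝ) : Prop :=
  ∀ (a₀ θ₀ : T3 → ℝ) (u₀ : T3 → V3), Continuous a₀ → Continuous θ₀ → Continuous u₀ → (∀ x, 0 < a₀ x) →
    (∀ x, 0 < θ₀ x) → ∃ σ₀ : ℝ, 0 < σ₀ ∧ ∀ σ : ℝ, 0 < σ → σ < σ₀ →
    ∀ (T : ℝ) (ρ θ : ℝ → T3 → ℝ) (u : ℝ → T3 → V3), IsHardSphereEulerSolution σ T ρ u θ →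
    (∀ t ∈ Set.Ico 0 T, ∀ x, ρ t x * σ ^ 3 < η) →
    ∀ Φ : (N : ℕ) → HardSphereFlow (Torus.geometry (Fin 3)) (hsDiameter σ N) (N + 1),
    TendstoHydroFieldsAt (fun N => localGibbsLaw σ a₀ u₀ θ₀ N (Φ N)) Φ ρ u θ 0 →
    ∀ t ∈ Set.Ico 0 T, ∃ C : ℝ, 0 ≤ C ∧ ∀ τ : ℝ, 0 < τ → ∃ N₀ : ℕ, ∀ N : ℕ, N₀ ≤ N → ∀ s ∈ Set.Icc 0 t,
      (let w : ℝ := τ * ((N : ℝ) + 1) ^ (-(1 / 3 : ℝ))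
       let P := localGibbsLaw σ a₀ u₀ θ₀ N (Φ N)
       let act := fun (i : Fin (N + 1)) (z : Config (N + 1) (Fin 3) T3) =>
         σ / τ * (Φ N).collisionSum (Set.Ioc s (s + w))
           (fun c => if c.fst = i then ‖c.postVel.1 - c.preVel.1‖ + |‖c.postVel.1‖ ^ 2 - ‖c.preVel.1‖ ^ 2| / 2
             else 0) z
       ∫⁻ z, ENNReal.ofReal (((N : ℝ) + 1)⁻¹ * ∑ i : Fin (N + 1), act i z) ∂P ≤ ENNReal.ofReal C)

/-- `MeanWindowTransferActivityBelow η` for SOME packing level `η > 0`. -/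
def MeanWindowTransferActivityInBand : Prop :=
  ∃ η : ℝ, 0 < η ∧ MeanWindowTransferActivityBelow η

/-- Antitonicity of the per-window mean transfer activity in the packing level. -/
theorem meanWindowTransferActivityBelow_antitone {η η' : ℝ} (hle : η' ≤ η) :
    MeanWindowTransferActivityBelow η → MeanWindowTransferActivityBelow η' := by
  intro H a₀ θ₀ u₀ ha hθ hu hap hθp
  obtain ⟨σ₀, hσ₀, G⟩ := H a₀ θ₀ u₀ ha hθ hu hap hθp
  exact ⟨σ₀, hσ₀, fun σ hσ hσ' T ρ θ u hE hguard =>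
    G σ hσ hσ' T ρ θ u hE fun t ht x => (hguard t ht x).trans_le hle⟩

/-! ### (e) The visible functional of the `N`-system and the visible one-block estimate -/

/-- **VISIBILITY of particle `i` in the `N`-system** with reference fields `(ρs, us)` frozen at the window
start: SLOW relative to the local drift, `‖vᵢ − us(xᵢ)‖ ≤ K`, AND locally dilute at the mesoscopic scale
`R (N+1)^{-1/3}`: the uncut cone-kernel empirical density around `xᵢ` (self included; `(N+1)⁻¹ Σⱼ cone`, so its
mean is the local density) is at most `(3/2) ρs(xᵢ)` (AUDIT-4a § 3: `Visible` of part A § 2 transcribed, the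
threshold `3/2` of the unit-density `M`-system becoming `(3/2) ρ_s(xᵢ)`). -/
def VisibleN (ρs : T3 → ℝ) (us : T3 → V3) (R K : ℝ) (N : ℕ) (z : Config (N + 1) (Fin 3) T3)
    (i : Fin (N + 1)) : Prop :=
  ‖(z i).2 - us (z i).1‖ ≤ K ∧ ((N : ℝ) + 1)⁻¹ * ∑ j, cone R N (z i).1 (z j).1 ≤ 3 / 2 * ρs (z i).1

/-- Visibility is decided classically (it guards `if … then … else` in the functionals). -/
instance instDecidableVisibleN (ρs : T3 → ℝ) (us : T3 → V3) (R K : ℝ) (N : ℕ)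
    (z : Config (N + 1) (Fin 3) T3) (i : Fin (N + 1)) : Decidable (VisibleN ρs us R K N z i) :=
  Classical.dec _

/-- Cone-smoothed (block scale `k (N+1)^{-1/3}`) empirical DENSITY of the VISIBLE particles at `x`:
`ρ̄(x) = (N+1)⁻¹ Σᵢ 𝟙(visible i) cone k N x xᵢ` (the `let ρ` of `visCore`). -/
def visDensityN (ρs : T3 → ℝ) (us : T3 → V3) (R K k : ℝ) (N : ℕ) (z : Config (N + 1) (Fin 3) T3)
    (x : T3) : ℝ :=
  ((N : ℝ) + 1)⁻¹ * ∑ i, (if VisibleN ρs us R K N z i then cone k N x (z i).1 else 0)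

/-- Cone-smoothed empirical MOMENTUM of the visible particles at `x` (the `let m` of `visCore`). -/
def visMomentumN (ρs : T3 → ℝ) (us : T3 → V3) (R K k : ℝ) (N : ℕ) (z : Config (N + 1) (Fin 3) T3)
    (x : T3) : V3 :=
  ((N : ℝ) + 1)⁻¹ • ∑ i, (if VisibleN ρs us R K N z i then cone k N x (z i).1 • (z i).2 else 0)

/-- Cone-smoothed empirical KINETIC ENERGY of the visible particles at `x` (the `let e` of `visCore`). -/
def visEnergyN (ρs : T3 → ℝ) (us : T3 → V3) (R K k : ℝ) (N : ℕ) (z : Config (N + 1) (Fin 3) T3)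
    (x : T3) : ℝ :=
  ((N : ℝ) + 1)⁻¹ * ∑ i, (if VisibleN ρs us R K N z i then cone k N x (z i).1 * ‖(z i).2‖ ^ 2 / 2 else 0)

/-- **The VISIBLE core of the `N`-system, `X_vis^N`** (AUDIT-4a § 3, last paragraph): `visCore` of part A § 2
transcribed from the homogeneous `(M+1)`-system to `N + 1` spheres of diameter `ε_N = hsDiameter σ N` under the
flow `Φ`, over the window `(s, s + w]`, `w = τ (N+1)^{-1/3}`, as a LAW-FREE function of the datum `z`:
`w⁻¹ [∫_s^{s+w} kin(Φ_r z) dr + Σ_(collision times r ∈ (s, s+w]) coll(Φ_{r⁻} z, Φ_r z) − ∫_s^{s+w} flux(Φ_r z) dr]`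
with the SAME three pieces as `visCore` — kinetic currents `⟨A₀(xᵢ), vᵢ⟩ + A(xᵢ) : vᵢ ⊗ vᵢ + ⟨A₄(xᵢ), vᵢ⟩|vᵢ|²/2` of
the visible particles; collisional transfer of momentum / kinetic energy of the particles visible before AND after
the collision, line-integrated along the contact segment; the Euler flux of the cone-smoothed visible block fields
`(ρ̄, m̄, ē)`, `w̄ = ρ̄⁻¹ m̄`, `p = ρ̄ (2/3)(ē/ρ̄ − |w̄|²/2) Z`, tested against `(A₀, A, A₄)` — up to: (i) reference
parameters = the frozen fields `(ρs, us)` (visibility `VisibleN ρs us R K`), (ii) arbitrary fixed smooth test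
fields `A₀ A₄ : 𝕋³ → ℝ³`, `A : Fin 3 → 𝕋³ → ℝ³`, (iii) EOS argument `min(ρ̄(x), 2 ρs(x)) σ³` in `Z = hsCompressibility`
(the packing cap `2` of the unit-density system becomes `2 ρ_s(x)`), (iv) the window `(s, s + w]` along `Φ.flow`.
Linear in `(A₀, A, A₄)`.  Junk: `ρ̄⁻¹ = 0` where no visible particle is seen from `x`; `‖Δ‖⁻¹ = 0` for a null
momentum transfer; `Function.leftLim` / `finsum` junk off the good set (an infinite collision-time set makes the
collision piece `0`); interval / Bochner integrals of non-integrable integrands are `0`. -/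
def visCoreN (σ : ℝ) (ρs : T3 → ℝ) (us : T3 → V3) (A₀ A₄ : T3 → V3) (A : Fin 3 → T3 → V3)
    (R K τ k : ℝ) (N : ℕ) (Φ : HardSphereFlow (Torus.geometry (Fin 3)) (hsDiameter σ N) (N + 1))
    (s : ℝ) (z : Config (N + 1) (Fin 3) T3) : ℝ :=
  let w : ℝ := τ * ((N : ℝ) + 1) ^ (-(1 / 3 : ℝ))
  let ε : ℝ := hsDiameter σ N
  let kin : Config (N + 1) (Fin 3) T3 → ℝ := fun y => ∑ i, if VisibleN ρs us R K N y i then ⟪A₀ (y i).1, (y i).2⟫_ℝ + (∑ j, ⟪A j (y i).1, (y i).2⟫_ℝ * (y i).2 j) + ⟪A₄ (y i).1, (y i).2⟫_ℝ * ‖(y i).2‖ ^ 2 / 2 else 0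
  let coll : Config (N + 1) (Fin 3) T3 → Config (N + 1) (Fin 3) T3 → ℝ := fun yl yr => ∑ i, (let Δ : V3 := (yr i).2 - (yl i).2; let ω : V3 := ‖Δ‖⁻¹ • Δ; if VisibleN ρs us R K N yl i ∧ VisibleN ρs us R K N yr i then ε / 2 * ∫ r in (0 : ℝ)..1, ((∑ j, ⟪A j ((yr i).1 + Torus.proj (-(r * ε) • ω)), ω⟫_ℝ * Δ j) + ⟪A₄ ((yr i).1 + Torus.proj (-(r * ε) • ω)), ω⟫_ℝ * (‖(yr i).2‖ ^ 2 - ‖(yl i).2‖ ^ 2) / 2) else 0)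
  let flux : Config (N + 1) (Fin 3) T3 → ℝ := fun y => ((N : ℝ) + 1) * ∫ x, (let ρ : ℝ := visDensityN ρs us R K k N y x; let m : V3 := visMomentumN ρs us R K k N y x; let e : ℝ := visEnergyN ρs us R K k N y x; let wb : V3 := ρ⁻¹ • m; let p : ℝ := ρ * (2 / 3 * (e / ρ - ‖wb‖ ^ 2 / 2)) * hsCompressibility (min ρ (2 * ρs x) * σ ^ 3); ⟪A₀ x, m⟫_ℝ + (∑ j, (⟪A j x, m⟫_ℝ * wb j + p * A j x j)) + ⟪A₄ x, wb⟫_ℝ * (e + p))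
  w⁻¹ * ((∫ r in s..(s + w), kin (Φ.flow r z)) + (∑ᶠ r ∈ collisionTimes (Torus.geometry (Fin 3)) ε (fun r' => Φ.flow r' z) ∩ Set.Ioc s (s + w), coll (Function.leftLim (fun r' => Φ.flow r' z) r) (Φ.flow r z)) - ∫ r in s..(s + w), flux (Φ.flow r z))

/-- **The VISIBLE ONE-BLOCK ESTIMATE IN THE BAND** — the conclusion of v7's stub 4a-i
`VisibleFluxGibbsianity → VisibleOneBlockEstimateInBand` (THE ball-wise localisation, AUDIT-4a § 3 items 1–4 and
last paragraph; to be proved in `L¹`/splice form, never at pressure level) and the first antecedent of stub 4a-ii.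
For every insertion factor `Rf` on `[0, r)` — the `∀ (r : ℝ) (Rf : ℝ → ℝ), 0 < r → … →` prefix of
`HydroLimitInBandHeart.WindowClauseInBand` VERBATIM (six hypotheses), so that 4a-ii docks — there is a packing
level `ηv > 0` (prover-chosen, `≤ r` and inside the VLFG box) such that along every classical solution guarded
at `ηv` and every flow family with local Gibbs data converging at `t = 0`:
`∀ t ∈ (0,T) ∃ β₀ > 0 ∃ K_ov ≥ 0 ∀ smooth test fields (A₀, A₄, A) of sup ≤ β₀ ∀ δ > 0 ∃ K₀ ∀ K ≥ K₀ ∀ R ≥ K₀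
∃ τ₀ > 0 ∀ τ ≥ τ₀ ∃ k₀ ∀ k ≥ k₀ ∃ N₀ ∀ N ≥ N₀ ∀ s ≥ 0 with s + w ≤ t` (`w = τ(N+1)^{-1/3}`): the window functional
`z ↦ visCoreN σ (ρ s) (u s) A₀ A₄ A R K τ k N (Φ N) s z` is `P`-integrable (`P` the initial local Gibbs law) and
`E_P[w · visCoreN] ≤ w · (K_ov · H_N(s) + δ (N+1))`, `H_N(s) := (klDiv ((Φ N).lawAt P s) ψ_s^N).toReal` along the
EXPLICIT reference family `ψ_s^N = localGibbsLaw σ (ρ_s · Rf(σ³ρ_s)) (u s) (θ s) N (Φ N)` of the window clause.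
Reading: locally invariant states carry VISIBLE block-recentred anomalous current at most `K_ov ×` their relative
entropy w.r.t. the local Gibbs reference (`K_ov` absorbs the overlap multiplicity of the ball cover and `1/2` from
the doubled exponent; fixed BEFORE `δ`, as the Grönwall constant of `WindowClauseInBand` requires); the test fields
are FIXED (VLFG is pointwise in the fields) — the time grid for the Euler fields `∇λ_s` is owed by 4a-ii with
`MeanWindowTransferActivityBelow` (AUDIT-4a § 2 (e3)).  Junk: `klDiv = ⊤ ↦ 0` (excluded along the line);
integrability is ASSERTED (a Bochner-junk `0` would make the inequality vacuous); `t < w` makes it vacuous. -/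
def VisibleOneBlockEstimateInBand : Prop :=
  ∀ (r : ℝ) (Rf : ℝ → ℝ), 0 < r →
    (∃ p : FormalMultilinearSeries ℝ ℝ ℝ, HasFPowerSeriesOnBall Rf p 0 (ENNReal.ofReal r)) →
    (∃ L : NNReal, LipschitzOnWith L Rf (Icc 0 r)) →
    (∀ x ∈ Ioo (-r) r, 0 < Rf x ∧ Rf x * (∑' j : ℕ, bE j / (j.factorial : ℝ) * (x * Rf x) ^ j) = 1) →
    (∀ x ∈ Icc 0 r, 1 ≤ Rf x ∧ Rf x ≤ 2) → ContinuousOn Rf (Icc 0 r) →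
    (∀ x ∈ Ioo (-r) r, ∀ R ∈ Icc (1 / 2 : ℝ) 2,
      R * (∑' j : ℕ, bE j / (j.factorial : ℝ) * (x * R) ^ j) = 1 → R = Rf x) →
    ∃ ηv : ℝ, 0 < ηv ∧
    ∀ (a₀ θ₀ : T3 → ℝ) (u₀ : T3 → V3), Continuous a₀ → Continuous θ₀ → Continuous u₀ →
      (∀ x, 0 < a₀ x) → (∀ x, 0 < θ₀ x) →
      ∃ σ₀ : ℝ, 0 < σ₀ ∧ ∀ σ : ℝ, 0 < σ → σ < σ₀ →
        ∀ (T : ℝ) (ρ θ : ℝ → T3 → ℝ) (u : ℝ → T3 → V3), IsHardSphereEulerSolution σ T ρ u θ →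
          (∀ s ∈ Set.Ico 0 T, ∀ x, ρ s x * σ ^ 3 < ηv) →
          ∀ Φ : (N : ℕ) → HardSphereFlow (Torus.geometry (Fin 3)) (hsDiameter σ N) (N + 1),
            TendstoHydroFieldsAt (fun N => localGibbsLaw σ a₀ u₀ θ₀ N (Φ N)) Φ ρ u θ 0 →
            ∀ t ∈ Set.Ioo 0 T, ∃ β₀ : ℝ, 0 < β₀ ∧ ∃ Kov : ℝ, 0 ≤ Kov ∧
              ∀ (A₀ A₄ : T3 → V3) (A : Fin 3 → T3 → V3), Torus.IsSmooth A₀ → Torus.IsSmooth A₄ →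
                (∀ j, Torus.IsSmooth (A j)) → (∀ x, ‖A₀ x‖ ≤ β₀) → (∀ x, ‖A₄ x‖ ≤ β₀) → (∀ j x, ‖A j x‖ ≤ β₀) →
              ∀ δ : ℝ, 0 < δ → ∃ K₀ : ℝ, ∀ K : ℝ, K₀ ≤ K → ∀ R : ℝ, K₀ ≤ R →
              ∃ τ₀ : ℝ, 0 < τ₀ ∧ ∀ τ : ℝ, τ₀ ≤ τ → ∃ k₀ : ℝ, ∀ k : ℝ, k₀ ≤ k →
              ∃ N₀ : ℕ, ∀ N : ℕ, N₀ ≤ N → ∀ s : ℝ, 0 ≤ s → s + τ * ((N : ℝ) + 1) ^ (-(1 / 3 : ℝ)) ≤ t →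
                Integrable (fun z => visCoreN σ (ρ s) (u s) A₀ A₄ A R K τ k N (Φ N) s z)
                    (localGibbsLaw σ a₀ u₀ θ₀ N (Φ N)) ∧
                ∫ z, τ * ((N : ℝ) + 1) ^ (-(1 / 3 : ℝ)) * visCoreN σ (ρ s) (u s) A₀ A₄ A R K τ k N (Φ N) s z
                    ∂(localGibbsLaw σ a₀ u₀ θ₀ N (Φ N)) ≤
                  τ * ((N : ℝ) + 1) ^ (-(1 / 3 : ℝ)) *
                    (Kov * (InformationTheory.klDiv ((Φ N).lawAt (localGibbsLaw σ a₀ u₀ θ₀ N (Φ N)) s)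
                        (localGibbsLaw σ (fun x => ρ s x * Rf (σ ^ 3 * ρ s x)) (u s) (θ s) N (Φ N))).toReal +
                      δ * ((N : ℝ) + 1))

/-- **(d) MESOSCOPIC BLOCK STATICS OF THE LOCAL GIBBS REFERENCE (`MesoscopicBlockLD`)** — the static input of the
quadratic one-block remainder of v7's stub 4a-ii (AUDIT-4a § 2 (d), § 3 item 5): VLFG is block-centred, so Yau's
remainder `Σ_blocks ∇λ : [F(η̄) − F(U) − F′(U)(η̄ − U)]` reappears and must be priced under the reference `ψ_s^N`
by the entropy inequality at an `O(1)` exchange rate.  TRUE-grade statics (low-density canonical hard-sphere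
Gibbs measure: cluster expansion / Dobrushin uniqueness ⇒ CLT-scale concentration; Spohn1991 §3.3,
KipnisLandim1999 App. 2), typed for the EXPLICIT reference family of the window clause — activity
`ρ₀ · Rf(σ³ρ₀)` with UNIT MASS `∫ ρ₀ = 1`, so that the density profile of the canonical law IS `ρ₀` and no
identification step is needed (same `(r, Rf)` prefix as `VisibleOneBlockEstimateInBand`; Euler solutions of the
line have unit mass) — and for one-parameter FAMILIES of profiles `s ↦ (ρ₀ s, wv s, ϑ s)` continuous on the
slab `[0, t₁] × 𝕋³` with `∀ s ∈ [0, t₁]` INNERMOST (the family-uniform typing an entropy clock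
along a time-dependent reference consumes, cf. `KineticCurrentsWindowLDFamily`; the Euler fields of 4a-ii satisfy
the `ContinuousOn` hypotheses by `Torus.continuousOn_uncurry_of_continuousOn_stLift`).  Two clauses, in the
dilute band `ρ₀σ³ < η₀`:
(i) GAUSSIAN-SCALE EXPONENTIAL MOMENTS of the cone-smoothed VISIBLE empirical density and momentum around the
profile: `∃ a₀ > 0 ∃ C ≥ 0 ∀ ε > 0 ∃ K₀ ∀ K ≥ K₀ ∀ R ≥ K₀ ∃ k₀ > 0 ∀ k ≥ k₀ ∃ N₀ ∀ N ≥ N₀ ∀ Φ ∀ s ∈ [0,t₁] ∀ a ∈ [0,a₀]`,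
`∫ exp(a (N+1) ∫_𝕋³ (ρ̄(x) − ρ₀(x))² + ‖m̄(x) − ρ₀(x) wv(x)‖² dx) dψ ≤ exp(a (N+1) (C/k³ + ε))` — blocks of side
`k(N+1)^{-1/3}` carry `≍ k³` particles, `(N+1) ∫ |η̄ − U|² ≍ Σ_blocks k³ |η̄_bl − U_bl|²` is `O(1)` per block at CLT
scale, `(N+1)/k³` in total; `ε` absorbs the deterministic bias of the visibility cut (fast fraction `e^{−K²/2ϑ}`,
`ψ`-dense fraction at scale `R`) and `N₀(k)` the smoothing bias `O(k(N+1)^{-1/3})`; the exchange rate `a₀` is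
`K, R`-FREE (velocity fluctuations are Gaussian, removing particles from visibility is an event of extensive
`ψ`-cost), which is what the Grönwall constant of `WindowClauseInBand` (fixed before `ε`) needs.  The kinetic
ENERGY is deliberately absent: the Euler flux is affine in the energy density, and the energy-direction terms of the
remainder (energy × momentum cross term, cubic coherent block drift) are NOT entropy-priceable at an `O(1)` rate
(chi-square tails, `a₀ ≲ 1/(ϑK²)`: the HighMomentumCutoff mechanism of SEET / CSCV-W) — 4a-ii routes them through
`EnergyCurrentTailsBelow η` and a coherence input, see the v7 notes.
(ii) EXPONENTIAL SMALLNESS OF THE QUADRATIC CONTENT OF THE MESOSCOPICALLY DENSE PARTICLES: `∃ lam₀ > 0 ∀ lam ∈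
(0, lam₀] ∀ ε > 0 ∃ R₀ > 0 ∀ R ≥ R₀ ∃ N₀ ∀ N ≥ N₀ ∀ Φ ∀ s ∈ [0,t₁]`,
`∫ exp(lam · Σᵢ 𝟙{(5/4) ρ₀(xᵢ) < (N+1)⁻¹ Σⱼ cone R N xᵢ xⱼ} (1 + ‖vᵢ − wv(xᵢ)‖²)) dψ ≤ exp(ε (N+1))` (the dense
indicator of `InvisibleCollisionThroughputW`; by the entropy inequality at rate `lam₀` it prices the number and the
mass / momentum / kinetic-energy CONTENT of the slow-but-dense particles that `visCoreN` drops, `≤ (H_N + ε(N+1))/lam₀`,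
and the dense half of 4a-iii).  The rate is CAPPED: an `R`-cone overdense clump of `≍ ρR³` particles has `ψ`-cost
AND `lam`-gain both linear in its size, so for `lam` above the clump cost rate the moment grows with `R` — `∀ lam`
would be false; likewise the CUBIC (energy-current) content of the dense particles is not priceable here at an
`O(1)` rate and is left to the true-law inputs of 4a-ii (v7 notes).  Junk: `ENNReal.ofReal ∘ Real.exp`, so an
infinite exponential moment is NOT a freebie; the laws do not depend on `Φ` (`localGibbsLaw_eq`). -/
def MesoscopicBlockLD : Prop :=
  ∀ (r : ℝ) (Rf : ℝ → ℝ), 0 < r →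
    (∃ p : FormalMultilinearSeries ℝ ℝ ℝ, HasFPowerSeriesOnBall Rf p 0 (ENNReal.ofReal r)) →
    (∃ L : NNReal, LipschitzOnWith L Rf (Icc 0 r)) →
    (∀ x ∈ Ioo (-r) r, 0 < Rf x ∧ Rf x * (∑' j : ℕ, bE j / (j.factorial : ℝ) * (x * Rf x) ^ j) = 1) →
    (∀ x ∈ Icc 0 r, 1 ≤ Rf x ∧ Rf x ≤ 2) → ContinuousOn Rf (Icc 0 r) →
    (∀ x ∈ Ioo (-r) r, ∀ R ∈ Icc (1 / 2 : ℝ) 2,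
      R * (∑' j : ℕ, bE j / (j.factorial : ℝ) * (x * R) ^ j) = 1 → R = Rf x) →
    ∃ η₀ : ℝ, 0 < η₀ ∧ ∀ (t₁ : ℝ) (ρ₀ ϑ : ℝ → T3 → ℝ) (wv : ℝ → T3 → V3),
      ContinuousOn (Function.uncurry ρ₀) (Set.Icc 0 t₁ ×ˢ Set.univ) →
      ContinuousOn (Function.uncurry ϑ) (Set.Icc 0 t₁ ×ˢ Set.univ) →
      ContinuousOn (Function.uncurry wv) (Set.Icc 0 t₁ ×ˢ Set.univ) →
      (∀ s ∈ Set.Icc 0 t₁, ∀ x, 0 < ρ₀ s x) → (∀ s ∈ Set.Icc 0 t₁, ∀ x, 0 < ϑ s x) →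
      (∀ s ∈ Set.Icc 0 t₁, ∫ x, ρ₀ s x = 1) →
      ∀ σ : ℝ, 0 < σ → (∀ s ∈ Set.Icc 0 t₁, ∀ x, ρ₀ s x * σ ^ 3 < η₀) →
      (∃ a₀ : ℝ, 0 < a₀ ∧ ∃ C : ℝ, 0 ≤ C ∧ ∀ ε : ℝ, 0 < ε → ∃ K₀ : ℝ, ∀ K : ℝ, K₀ ≤ K → ∀ R : ℝ, K₀ ≤ R →
        ∃ k₀ : ℝ, 0 < k₀ ∧ ∀ k : ℝ, k₀ ≤ k → ∃ N₀ : ℕ, ∀ N : ℕ, N₀ ≤ N →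
        ∀ Φ : HardSphereFlow (Torus.geometry (Fin 3)) (hsDiameter σ N) (N + 1),
        ∀ s ∈ Set.Icc 0 t₁, ∀ a ∈ Set.Icc 0 a₀,
          ∫⁻ z, ENNReal.ofReal (Real.exp (a * (((N : ℝ) + 1) *
              ∫ x, ((visDensityN (ρ₀ s) (wv s) R K k N z x - ρ₀ s x) ^ 2 +
                ‖visMomentumN (ρ₀ s) (wv s) R K k N z x - ρ₀ s x • wv s x‖ ^ 2))))
            ∂(localGibbsLaw σ (fun x => ρ₀ s x * Rf (σ ^ 3 * ρ₀ s x)) (wv s) (ϑ s) N Φ) ≤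
          ENNReal.ofReal (Real.exp (a * (((N : ℝ) + 1) * (C / k ^ 3 + ε))))) ∧
      (∃ lam₀ : ℝ, 0 < lam₀ ∧ ∀ lam : ℝ, 0 < lam → lam ≤ lam₀ → ∀ ε : ℝ, 0 < ε →
        ∃ R₀ : ℝ, 0 < R₀ ∧ ∀ R : ℝ, R₀ ≤ R → ∃ N₀ : ℕ, ∀ N : ℕ, N₀ ≤ N →
        ∀ Φ : HardSphereFlow (Torus.geometry (Fin 3)) (hsDiameter σ N) (N + 1), ∀ s ∈ Set.Icc 0 t₁,
          ∫⁻ z, ENNReal.ofReal (Real.exp (lam * ∑ i : Fin (N + 1),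
              (if 5 / 4 * ρ₀ s (z i).1 < ((N : ℝ) + 1)⁻¹ * ∑ j : Fin (N + 1), cone R N (z i).1 (z j).1
                then 1 + ‖(z i).2 - wv s (z i).1‖ ^ 2 else 0)))
            ∂(localGibbsLaw σ (fun x => ρ₀ s x * Rf (σ ^ 3 * ρ₀ s x)) (wv s) (ϑ s) N Φ) ≤
          ENNReal.ofReal (Real.exp (ε * ((N : ℝ) + 1))))

/-- **(f) Registered bookkeeping stub `stub_objectsV7` of skeleton v7** (AUDIT-4a typing): antitonicity in the
packing level of the three new guarded inputs (a)–(c), and (a) ⇒ (b).  Sorry-free. -/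
theorem stub_objectsV7 : (∀ η η' : ℝ, η' ≤ η → Summit.AtomisticToContinuum.HydrodynamicLimit.Theorems.LTEInBand.InvisibleCollisionThroughputW η → Summit.AtomisticToContinuum.HydrodynamicLimit.Theorems.LTEInBand.InvisibleCollisionThroughputW η') ∧ (∀ η η' : ℝ, η' ≤ η → Summit.AtomisticToContinuum.HydrodynamicLimit.Theorems.LTEInBand.FastCollisionThroughputW η → Summit.AtomisticToContinuum.HydrodynamicLimit.Theorems.LTEInBand.FastCollisionThroughputW η') ∧ (∀ η η' : ℝ, η' ≤ η → Summit.AtomisticToContinuum.HydrodynamicLimit.Theorems.LTEInBand.MeanWindowTransferActivityBelow η → Summit.AtomisticToContinuum.HydrodynamicLimit.Theorems.LTEInBand.MeanWindowTransferActivityBelow η') ∧ (∀ η : ℝ, Summit.AtomisticToContinuum.HydrodynamicLimit.Theorems.LTEInBand.InvisibleCollisionThroughputW η → Summit.AtomisticToContinuum.HydrodynamicLimit.Theorems.LTEInBand.FastCollisionThroughputW η) :=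
  ⟨fun _ _ h => invisibleCollisionThroughputW_antitone h, fun _ _ h => fastCollisionThroughputW_antitone h,
    fun _ _ h => meanWindowTransferActivityBelow_antitone h, fun _ => fastCollisionThroughputW_of_invisible⟩

end Summit.AtomisticToContinuum.HydrodynamicLimit.Theorems.LTEInBand

end
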